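import Summits.NavierStokesRegularity.NavierStokesRegularity.Theses.TypeICertificateLadder
import Summits.NavierStokesRegularity.NavierStokesRegularity.Theorems.Target.Negative.EnergyClassLoadBearing
import Summits.NavierStokesRegularity.NavierStokesRegularity.Theorems.SqueezeCycleExtremalBiaxialitySubcriticalSmallConstant
import Literature.Analysis.FluidPDE.TypeIAncientMild
import Literature.Analysis.FluidPDE.KNSSRemark61

/-!
# Crux `Target` = `TypeICertificateLadder.NoTypeIBlowup` (stmt-NavierStokesRegularity-1217),
# line `head-flux-channel`, stub S1a `stub_typeIZoom`: the Leray–Hopf clause is load-bearing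
# AT THE STUB LEVEL, and it is cashed in as OSEEN-MILDNESS of the physical solution

Negative-side (drefute, D-0016) lemmas on the Type-I ZOOM stub of the picked line
(`Cruxes/Target/Lines/head-flux-channel.lean`, S1a):

  S1a: a classical solution on `ℝ³ × [0,T)`, Leray–Hopf from its rapidly decaying datum, with the
  eventual rate `√(T−t)‖u(t,x)‖ ≤ C√ν` and no classical extension past `T`, generates a
  NONTRIVIAL Type-I ancient mild field `ū` with the SAME constant `C` (`IsTypeIAncientMild C ū`).

* `stub_typeIZoom_false_without_lerayHopf` — with the clause `IsLerayHopfOn T ν 0 (u 0) u`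
  DELETED, S1a is FALSE. Witness: the drift flow `u = −log(1−t) e₀`, `p = −(1−t)⁻¹ x₀`
  (`driftVel`/`driftPres`, KNSS 2009 §1 p. 3 parasitic family; tree
  `Target.Negative.isClassical_drift`), `ν = T = 1`: classical on `[0,1)`, datum `0`, NO classical
  extension (`not_hasSmoothExtensionPast_drift`), and — new here — it obeys the eventual rate with
  EVERY constant `C > 0` (`eventually_rate_drift`: `√(1−t)·(−log(1−t)) → 0` as `t ↑ 1`). Taking `C = ε`, the
  universal small constant of the tree's ancient Leray bound
  `Theorems.exists_typeIAncientMild_eq_zero_of_small` (every `IsTypeIAncientMild C ū` with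
  `C ≤ ε` vanishes), the conclusion of S1a would produce a nontrivial element of a trivial class.
* `stub_typeIZoom_false_without_energy_even_bounded` — the same witness is a pressure-free WEAK
  solution (`isWeakNSSolutionOn_drift`) and is BOUNDED on every earlier slab `[0,T'] × ℝ³`,
  `T' < T` (`norm_driftVel_le_of_le`); so replacing the Leray–Hopf clause by the weak formulation
  PLUS slab-boundedness before `T` is STILL false: boundedness before `T` (the content of
  `CounterexampleProfile.pointwise_bounded_before`) is not what the zoom needs from finite energy.
* `not_oseen_pairs_drift` — what the witness LACKS is exactly the Oseen integral equation between
  pairs of times (`u(t) = e^{(t−s)Δ}u(s) − B¹_s(u,u)(t)`): for the drift the right-hand side is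
  `u(s)` (the heat flow fixes constants, the Duhamel term of slice-constant fields vanishes,
  `oseenDuhamel_eq_zero_of_const`), while `−log(1−t)` is strictly increasing. Hence the
  load-bearing use of the energy class in S1a is the lead's sub-goal `typeIZoom_oseen_pairs`
  (Clay-class solution ⇒ Oseen equation between all pairs of times, via weak–strong uniqueness /
  the Kato identification), not boundedness and not the blow-up profile.

Nothing here closes the item (`--supports stmt-NavierStokesRegularity-1217`); no statement of the
route is asserted. [cite: KochNadirashviliSereginSverak2009, §1 p. 3 (parasitic solutions) and
Remark 6.1 (arXiv:0709.3599 p. 11); Leray1934, (3.9)]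
-/

noncomputable section

open MeasureTheory TopologicalSpace Set Function Filter Metric
open scoped Topology RealInnerProductSpace
open Literature.Analysis Literature.Analysis.FluidPDE

namespace Summit.NavierStokesRegularity.NavierStokesRegularity.Theorems.Target.Negative

set_option linter.dupNamespace false

/-- The speed of the drift flow is `|log(1 − t)|`. -/
theorem norm_driftVel (t : ℝ) (x : EuclideanSpace ℝ (Fin 3)) :
    ‖driftVel t x‖ = |Real.log (1 - t)| := by
  simp [driftVel, uniformVel_apply, driftAmp, norm_smul]

/-- **The drift flow obeys the eventual Type-I rate at `T = 1` with EVERY constant `C > 0`**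
(`√(1−t) · (−log(1−t)) → 0` as `t ↑ 1`; Mathlib `tendsto_log_mul_rpow_nhdsGT_zero`). -/
theorem eventually_rate_drift {C : ℝ} (hC : 0 < C) :
    ∀ᶠ t in 𝓝[<] (1 : ℝ), ∀ x : EuclideanSpace ℝ (Fin 3),
      Real.sqrt (1 - t) * ‖driftVel t x‖ ≤ C * Real.sqrt 1 := by
  have h1 : Tendsto (fun t : ℝ => 1 - t) (𝓝[<] 1) (𝓝[>] 0) := by
    refine tendsto_nhdsWithin_iff.2 ⟨?_, ?_⟩
    · have h : Tendsto (fun t : ℝ => 1 - t) (𝓝 1) (𝓝 (1 - 1)) :=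
        tendsto_const_nhds.sub tendsto_id
      rw [sub_self] at h
      exact h.mono_left nhdsWithin_le_nhds
    · filter_upwards [self_mem_nhdsWithin] with t ht
      exact mem_Ioi.2 (sub_pos.2 (mem_Iio.1 ht))
  have h2 : Tendsto (fun y : ℝ => Real.log y * y ^ (1 / 2 : ℝ)) (𝓝[>] 0) (𝓝 0) :=
    tendsto_log_mul_rpow_nhdsGT_zero (by norm_num)
  have h3 := h2.comp h1
  have hmem : Ioo (-C) C ∈ 𝓝 (0 : ℝ) := Ioo_mem_nhds (by linarith) hC
  have h4 := h3.eventually_mem hmem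
  filter_upwards [h4, self_mem_nhdsWithin] with t ht ht1 x
  have hy : 0 < 1 - t := sub_pos.2 (mem_Iio.1 ht1)
  have hr : 0 ≤ (1 - t) ^ (1 / 2 : ℝ) := Real.rpow_nonneg hy.le _
  have key : |Real.log (1 - t) * (1 - t) ^ (1 / 2 : ℝ)| < C := by
    simp only [Function.comp_apply, mem_Ioo] at ht
    exact abs_lt.2 ⟨ht.1, ht.2⟩
  rw [abs_mul, abs_of_nonneg hr] at key
  rw [Real.sqrt_one, mul_one, norm_driftVel, Real.sqrt_eq_rpow, mul_comm]
  exact key.le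

/-- **The drift flow is bounded on every earlier slab** `[0, T'] × ℝ³`, `T' < 1`:
`‖u(t, x)‖ = −log(1−t) ≤ −log(1−T')`. -/
theorem norm_driftVel_le_of_le {T' t : ℝ} (hT' : T' < 1) (ht0 : 0 ≤ t) (ht : t ≤ T')
    (x : EuclideanSpace ℝ (Fin 3)) :
    ‖driftVel t x‖ ≤ -Real.log (1 - T') := by
  have hy : 0 < 1 - T' := sub_pos.2 hT'
  have hlog : Real.log (1 - t) ≤ 0 := Real.log_nonpos (by linarith) (by linarith)
  have hmono : Real.log (1 - T') ≤ Real.log (1 - t) := Real.log_le_log hy (by linarith)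
  rw [norm_driftVel, abs_of_nonpos hlog]
  linarith

/-- **The drift flow does NOT satisfy the Oseen integral equation between pairs of times** of
`(0, 1)` (unit viscosity): `e^{(t−s)Δ}` fixes the constant slice `u(s) = −log(1−s)e₀`
(`heatExtension_const`) and the Duhamel term of slice-constant fields vanishes
(`oseenDuhamel_eq_zero_of_const`, the Oseen kernel has zero mean — KNSS 2009 Remark 6.1), so the
equation would force `log(1−t) = log(1−s)` for `s < t`. This is the clause of the Clay class
(obtained from finite energy by weak–strong uniqueness) that the parasitic witness violates. -/
theorem not_oseen_pairs_drift :
    ¬ (∀ s t : ℝ, 0 < s → s < t → t < 1 → ∀ x : EuclideanSpace ℝ (Fin 3),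
        driftVel t x = UnboundedOperators.heatExtension (driftVel s) (t - s) x -
          oseenDuhamel 1 s driftVel driftVel t x) := by
  intro h
  have hs : (0 : ℝ) < 1 / 4 := by norm_num
  have hst : (1 / 4 : ℝ) < 1 / 2 := by norm_num
  have ht : (1 / 2 : ℝ) < 1 := by norm_num
  have key := h (1 / 4) (1 / 2) hs hst ht 0
  have hD : oseenDuhamel 1 (1 / 4) driftVel driftVel (1 / 2) (0 : EuclideanSpace ℝ (Fin 3)) = 0 :=
    oseenDuhamel_eq_zero_of_const (b := fun τ => driftAmp τ • e₀)
      (c := fun τ => driftAmp τ • e₀) (fun τ _ y => rfl) (fun τ _ y => rfl) 0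
  have hus : driftVel (1 / 4) =
      fun _ : EuclideanSpace ℝ (Fin 3) => driftAmp (1 / 4) • e₀ := rfl
  have hσ : (0 : ℝ) < 1 / 2 - 1 / 4 := by norm_num
  rw [hD, sub_zero, hus, UnboundedOperators.heatExtension_const _ hσ] at key
  have key' : driftAmp (1 / 2) • e₀ = driftAmp (1 / 4) • e₀ := key
  have he : (e₀ : EuclideanSpace ℝ (Fin 3)) ≠ 0 := fun h0 => by
    have := norm_e₀
    rw [h0, norm_zero] at this
    exact zero_ne_one this
  have hamp : driftAmp (1 / 2) = driftAmp (1 / 4) := smul_left_injective ℝ he key'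
  have hlt : Real.log (1 - 1 / 2) < Real.log (1 - 1 / 4) :=
    Real.log_lt_log (by norm_num) (by norm_num)
  simp only [driftAmp] at hamp
  linarith

/-- **S1a (`stub_typeIZoom`) is FALSE without the Leray–Hopf clause.** The statement below is the
stub verbatim with `IsLerayHopfOn T ν 0 (u 0) u →` deleted. Refutation: `ν = T = 1`, the drift
flow, and `C = ε` from `exists_typeIAncientMild_eq_zero_of_small` (ancient Leray bound: the class
`IsTypeIAncientMild C` is `{0}` for `C ≤ ε`), against which the stub's conclusion asks for a
NONTRIVIAL element. So any proof of S1a uses finite energy — and by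
`stub_typeIZoom_false_without_energy_even_bounded` / `not_oseen_pairs_drift` it must use it to
obtain the Oseen integral equation of the physical solution. -/
theorem stub_typeIZoom_false_without_lerayHopf :
    ¬ (∀ C : ℝ, 0 < C → ∀ (ν T : ℝ), 0 < ν → 0 < T →
      ∀ (u : ℝ → EuclideanSpace ℝ (Fin 3) → EuclideanSpace ℝ (Fin 3))
        (p : ℝ → EuclideanSpace ℝ (Fin 3) → ℝ),
        IsClassicalNSSolutionOn (Set.Ico 0 T) ν 0 u p →
        HasRapidSpatialDecay (u 0) →
        (∀ᶠ t in 𝓝[<] T, ∀ x, Real.sqrt (T - t) * ‖u t x‖ ≤ C * Real.sqrt ν) →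
        ¬ HasSmoothExtensionPast ν 0 u T →
        ∃ (ū : ℝ → EuclideanSpace ℝ (Fin 3) → EuclideanSpace ℝ (Fin 3)),
          IsTypeIAncientMild C ū ∧ ¬ (∀ t < 0, ∀ x, ū t x = 0)) := by
  intro h
  obtain ⟨ε, hε, hsmall⟩ := exists_typeIAncientMild_eq_zero_of_small
  obtain ⟨ū, hA, hne⟩ := h ε hε 1 1 one_pos one_pos driftVel driftPres (isClassical_drift 1)
    (by rw [driftVel_zero]; exact hasRapidSpatialDecay_zero) (eventually_rate_drift hε)
    (not_hasSmoothExtensionPast_drift 1)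
  exact hne (hsmall ε ū hA le_rfl)

/-- **S1a stays FALSE with the weak formulation and slab-boundedness in place of Leray–Hopf.**
The stub with `IsLerayHopfOn T ν 0 (u 0) u` replaced by its first field
`IsWeakNSSolutionOn T ν 0 (u 0) u` (pressure-free weak form, all energy clauses deleted) AND the
extra hypothesis that `u` is bounded on every earlier slab `[0, T'] × ℝ³`, `T' < T`, is false —
same witness (`isWeakNSSolutionOn_drift`, `norm_driftVel_le_of_le`). Of the Leray–Hopf bundle
exactly the finite-energy clauses are load-bearing for the zoom, and not through boundedness
before `T`. -/
theorem stub_typeIZoom_false_without_energy_even_bounded :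
    ¬ (∀ C : ℝ, 0 < C → ∀ (ν T : ℝ), 0 < ν → 0 < T →
      ∀ (u : ℝ → EuclideanSpace ℝ (Fin 3) → EuclideanSpace ℝ (Fin 3))
        (p : ℝ → EuclideanSpace ℝ (Fin 3) → ℝ),
        IsClassicalNSSolutionOn (Set.Ico 0 T) ν 0 u p →
        IsWeakNSSolutionOn T ν 0 (u 0) u →
        HasRapidSpatialDecay (u 0) →
        (∀ T' < T, ∃ K : ℝ, ∀ t ∈ Set.Icc 0 T', ∀ x, ‖u t x‖ ≤ K) →
        (∀ᶠ t in 𝓝[<] T, ∀ x, Real.sqrt (T - t) * ‖u t x‖ ≤ C * Real.sqrt ν) →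
        ¬ HasSmoothExtensionPast ν 0 u T →
        ∃ (ū : ℝ → EuclideanSpace ℝ (Fin 3) → EuclideanSpace ℝ (Fin 3)),
          IsTypeIAncientMild C ū ∧ ¬ (∀ t < 0, ∀ x, ū t x = 0)) := by
  intro h
  obtain ⟨ε, hε, hsmall⟩ := exists_typeIAncientMild_eq_zero_of_small
  have hbdd : ∀ T' < (1 : ℝ), ∃ K : ℝ, ∀ t ∈ Set.Icc 0 T', ∀ x : EuclideanSpace ℝ (Fin 3),
      ‖driftVel t x‖ ≤ K :=
    fun T' hT' => ⟨-Real.log (1 - T'), fun t ht x => norm_driftVel_le_of_le hT' ht.1 ht.2 x⟩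
  obtain ⟨ū, hA, hne⟩ := h ε hε 1 1 one_pos one_pos driftVel driftPres (isClassical_drift 1)
    (isWeakNSSolutionOn_drift 1) (by rw [driftVel_zero]; exact hasRapidSpatialDecay_zero) hbdd
    (eventually_rate_drift hε) (not_hasSmoothExtensionPast_drift 1)
  exact hne (hsmall ε ū hA le_rfl)

end Summit.NavierStokesRegularity.NavierStokesRegularity.Theorems.Target.Negative

end
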